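import Summits.Ventures.PercRepro.C041ZoneSplitSymm

/-!
# The ZONE LEMMA on singleton zones, and the first end-to-end instance of the reduction (p6, gen 26; C-041.md §11,
SPECIAL CASE (ii))

mine-3's special case (ii) of the ZONE LEMMA: a zone that is a single anchor `k` with terminal multiplicities
`(k₁, k₂)` has `|𝓛_Z| = [k₁ ≥ 1 ∧ k₂ = 0]` (the all-blue colouring) and `|𝓡_Z| = [k₁ ≥ 1]` (`a`-edges red, `b`-edges
blue), so `|𝓛_Z| ≤ |𝓡_Z|`.  In the tree's encoding (`C041ZoneSplitDefs`), for an indexed zone `Z = {k}` without a bare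
loop at `k`: every zone-state of `𝓛_Z` is the all-blue colouring (`eq_allBlue_of_mem_Lset_singleton`), and when `𝓛_Z`
is non-empty the all-red colouring lies in `𝓡_Z` (`allRed_mem_Rset_singleton`); hence
**`card_Lset_le_card_Rset_singleton`**.  Consequently (**`invalidCount_le_mCountA_of_singleton_zones`**,
`inv_of_singleton_zones`): (INV) holds on every tail-free `O` all of whose indexed zones are singletons — the
first end-to-end instance of the REDUCTION THEOREM.
-/

namespace PercRepro

namespace MultiGraph

open Finset

variable {V E : Type*} {G : MultiGraph V E}

section Singleton

variable [Fintype V] (a b c : V) {O : Config E}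

omit [Fintype V] in
/-- An edge of the singleton zone `{k}` without a bare loop at `k` is a terminal edge at `k`. -/
theorem zoneEdge_singleton_iff {k : V} (hloop : ∀ e, G.Bare a b e → ¬ G.Joins e k k) (e : E) :
    G.ZoneEdge a b {k} e ↔ G.Joins e k a ∨ G.Joins e k b := by
  constructor
  · rintro (⟨hb, h1, h2⟩ | ⟨v, hv, hj⟩)
    · rw [Finset.mem_singleton] at h1 h2
      exact absurd (Or.inl ⟨h1, h2⟩) (hloop e hb)
    · rw [Finset.mem_singleton] at hv
      exact hv ▸ hj
  · intro h
    exact Or.inr ⟨k, Finset.mem_singleton_self k, h⟩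

omit [Fintype V] in
/-- A zone edge of the singleton zone is not bare. -/
theorem not_bare_of_zoneEdge_singleton {k : V} (hloop : ∀ e, G.Bare a b e → ¬ G.Joins e k k) {e : E}
    (he : G.ZoneEdge a b {k} e) : ¬ G.Bare a b e := by
  rcases (zoneEdge_singleton_iff a b hloop e).1 he with h | h
  · exact fun hb => hb.1 (EdgeAt.of_joins_right h)
  · exact fun hb => hb.2 (EdgeAt.of_joins_right h)

/-- In the extension of a zone-state of the singleton zone `{k} = zone k`, a blue bare walk from `k` stays at `k`. -/
theorem eq_of_blueBareConn_ext_singleton {k : V} (hk : G.zone a b O k = {k})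
    (hloop : ∀ e, G.Bare a b e → ¬ G.Joins e k k) (x : G.ZoneState a b {k}) {w : V}
    (h : G.BlueBareConn a b (G.extZone a b O {k} x) k w) : w = k := by
  induction h with
  | refl => rfl
  | @tail y z _ hyz ih =>
    rw [ih] at hyz
    obtain ⟨e, he, hSe, hj⟩ := hyz
    have hZe : ¬ G.ZoneEdge a b {k} e := fun hZe => not_bare_of_zoneEdge_singleton a b hloop hZe he
    rw [extZone_of_bare x hZe he] at hSe
    have : z ∈ G.zone a b O k := (mem_zone a b O).2 (BlueBareConn.single ⟨e, he, hSe, hj⟩)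
    rw [hk, Finset.mem_singleton] at this
    exact this

/-- Attachments of `k` in the extension of a zone-state of the singleton zone: a blue terminal edge at `k`. -/
theorem attached_ext_singleton_iff {k : V} (hk : G.zone a b O k = {k})
    (hloop : ∀ e, G.Bare a b e → ¬ G.Joins e k k) (x : G.ZoneState a b {k}) {t : V} (ht : t = a ∨ t = b) :
    G.Attached a b (G.extZone a b O {k} x) k t ↔
      ∃ e, ∃ h : G.ZoneEdge a b {k} e, x ⟨e, h⟩ = false ∧ G.Joins e k t := by
  constructor
  · rintro ⟨w, hkw, e, hSe, hj⟩
    have hw := eq_of_blueBareConn_ext_singleton a b hk hloop x hkw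
    subst hw
    have hZe : G.ZoneEdge a b {w} e := zoneEdge_of_terminal (Finset.mem_singleton_self w) ht hj
    refine ⟨e, hZe, ?_, hj⟩
    rw [extZone_of_zoneEdge x hZe] at hSe
    exact hSe
  · rintro ⟨e, hZe, hxe, hj⟩
    refine ⟨k, BlueBareConn.refl a b _ k, e, ?_, hj⟩
    rw [extZone_of_zoneEdge x hZe]
    exact hxe

variable [Fintype E] [DecidableEq E]

omit [Fintype E] [DecidableEq E] in
/-- The anchor of a singleton indexed zone lies in `K₀`. -/
theorem anchor_mem_of_isIdxZone_singleton {k : V} (hZ : G.IsIdxZone a b c O {k}) : k ∈ G.BareReach a b c O := by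
  obtain ⟨_, ⟨v, hv, hvK⟩, _⟩ := hZ
  rw [Finset.mem_singleton] at hv
  exact hv ▸ hvK

omit [Fintype E] [DecidableEq E] in
/-- The anchor of a singleton zone lies in `K_Z` of every zone-state. -/
theorem anchor_kZone_singleton {k : V} (hZ : G.IsIdxZone a b c O {k}) (S : Config E) :
    G.KZone a b c O S {k} k :=
  ⟨k, Finset.mem_singleton_self k, anchor_mem_of_isIdxZone_singleton a b c hZ, Relation.ReflTransGen.refl⟩

open Classical in
/-- **Every zone-state of `𝓛_Z` of a singleton zone is the all-blue colouring** («blue at `K`» at the anchor). -/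
theorem eq_allBlue_of_mem_Lset_singleton {k : V} (hZ : G.IsIdxZone a b c O {k})
    (hloop : ∀ e, G.Bare a b e → ¬ G.Joins e k k) {x : G.ZoneState a b {k}}
    (hx : x ∈ G.Lset a b c O {k}) : x = fun _ => false := by
  unfold Lset at hx
  simp only [Finset.mem_filter, Finset.mem_univ, true_and] at hx
  funext ⟨e, he⟩
  have hj := (zoneEdge_singleton_iff a b hloop e).1 he
  have := hx.2.1 k (anchor_kZone_singleton a b c hZ _) e hj
  rw [extZone_of_zoneEdge x he] at this
  exact this

/-- `𝓛_Z` of a singleton zone has at most one element. -/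
theorem card_Lset_singleton_le_one {k : V} (hZ : G.IsIdxZone a b c O {k})
    (hloop : ∀ e, G.Bare a b e → ¬ G.Joins e k k) : (G.Lset a b c O {k}).card ≤ 1 := by
  classical
  apply Finset.card_le_one.2
  intro x hx y hy
  rw [eq_allBlue_of_mem_Lset_singleton a b c hZ hloop hx, eq_allBlue_of_mem_Lset_singleton a b c hZ hloop hy]

open Classical in
/-- **When `𝓛_Z` of a singleton zone is non-empty, the all-red colouring lies in `𝓡_Z`**: the anchor `k ≠ c` then
carries an `a`-edge and no `b`-edge, and colouring its `a`-edges red leaves it undeleted, valid, and without a red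
`b`-edge. -/
theorem allRed_mem_Rset_singleton {k : V} (hk : G.zone a b O k = {k}) (hZ : G.IsIdxZone a b c O {k})
    (hloop : ∀ e, G.Bare a b e → ¬ G.Joins e k k) {x : G.ZoneState a b {k}} (hx : x ∈ G.Lset a b c O {k}) :
    (fun _ => true : G.ZoneState a b {k}) ∈ G.Rset a b c O {k} := by
  have hx' := hx
  unfold Lset at hx'
  simp only [Finset.mem_filter, Finset.mem_univ, true_and] at hx'
  obtain ⟨hadm, _, w, hw, _, hatt⟩ := hx'
  rw [Finset.mem_singleton] at hw
  subst hw
  -- `k` carries a blue `a`-edge, hence an `a`-edge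
  obtain ⟨e₀, he₀, _, hj₀⟩ := (attached_ext_singleton_iff a b hk hloop x (Or.inl rfl)).1 hatt
  -- no `b`-edge at `k`: a `b`-edge would be blue (all-blue) and make the sub-zone attached to both
  have hallBlue := eq_allBlue_of_mem_Lset_singleton a b c hZ hloop hx
  have hnob : ∀ e, ¬ G.Joins e w b := by
    intro e hj
    have hZe : G.ZoneEdge a b {w} e := (zoneEdge_singleton_iff a b hloop e).2 (Or.inr hj)
    apply hadm.2.2.1 w (Finset.mem_singleton_self w)
    refine ⟨hatt, (attached_ext_singleton_iff a b hk hloop x (Or.inr rfl)).2 ⟨e, hZe, ?_, hj⟩⟩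
    rw [hallBlue]
  -- `k ≠ c`
  have hkc : w ≠ c := by
    intro hwc
    subst hwc
    exact (hadm.2.2.2 (Finset.mem_singleton_self w)).1 hatt
  -- no attachment of `k` in the extension of the all-red colouring
  have hnoatt : ∀ t, (t = a ∨ t = b) →
      ¬ G.Attached a b (G.extZone a b O {w} (fun _ => true)) w t := by
    intro t ht h
    obtain ⟨e, hZe, he, _⟩ := (attached_ext_singleton_iff a b hk hloop _ ht).1 h
    exact absurd he (by decide)
  unfold Rset
  simp only [Finset.mem_filter, Finset.mem_univ, true_and]
  refine ⟨⟨fun e he hb _ => absurd hb (not_bare_of_zoneEdge_singleton a b hloop he),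
    fun e he hb _ _ => absurd hb (not_bare_of_zoneEdge_singleton a b hloop he), fun v hv h => ?_, fun hc => ?_⟩,
    ?_, ?_, ?_⟩
  · rw [Finset.mem_singleton] at hv
    subst hv
    exact hnoatt a (Or.inl rfl) h.1
  · rw [Finset.mem_singleton] at hc
    exact absurd hc.symm hkc
  · rintro ⟨v, hv, _, h⟩
    rw [Finset.mem_singleton] at hv
    subst hv
    exact hnoatt a (Or.inl rfl) h
  · intro v hv e hj
    have hvZ : v ∈ ({w} : Finset V) := mem_of_reachZone a b c hv
    rw [Finset.mem_singleton] at hvZ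
    subst hvZ
    exact absurd hj (hnob e)
  · refine ⟨w, anchor_kZone_singleton a b c hZ _, e₀, ?_, Or.inl hj₀⟩
    rw [extZone_of_zoneEdge _ he₀]

/-- **THE ZONE LEMMA ON SINGLETON ZONES** (C-041.md §11, special case (ii)): for an indexed zone `{k} = zone k` without
a bare loop at `k`, `#𝓛_Z ≤ #𝓡_Z`. -/
theorem card_Lset_le_card_Rset_singleton {k : V} (hk : G.zone a b O k = {k}) (hZ : G.IsIdxZone a b c O {k})
    (hloop : ∀ e, G.Bare a b e → ¬ G.Joins e k k) :
    (G.Lset a b c O {k}).card ≤ (G.Rset a b c O {k}).card := by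
  classical
  by_cases hL : (G.Lset a b c O {k}).Nonempty
  · obtain ⟨x, hx⟩ := hL
    exact (card_Lset_singleton_le_one a b c hZ hloop).trans
      (Finset.card_pos.2 ⟨_, allRed_mem_Rset_singleton a b c hk hZ hloop hx⟩)
  · rw [Finset.not_nonempty_iff_eq_empty.1 hL, Finset.card_empty]
    exact Nat.zero_le _

omit [Fintype E] [DecidableEq E] in
/-- The indexed zones of `O` are singletons: every indexed zone is `{k}` for its (unique) vertex `k`, with
`zone k = {k}`. -/
theorem zone_eq_singleton_of_isIdxZone {k : V} (hZ : G.IsIdxZone a b c O {k}) : G.zone a b O k = {k} := by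
  obtain ⟨⟨z, hz⟩, _, _⟩ := hZ
  have hkz : k ∈ G.zone a b O z := by
    rw [← hz]
    exact Finset.mem_singleton_self k
  rw [zone_eq_of_mem a b O hkz, ← hz]

/-- **THE FIRST END-TO-END INSTANCE OF THE REDUCTION THEOREM** (side `a`): on a tail-free `O` all of whose indexed
zones are singletons (and without bare loops), (INV) holds at every `u ∈ K₀`, with an edge between the terminals. -/
theorem invalidCount_le_mCountA_of_singleton_zones (hc : c ≠ a ∧ c ≠ b) (hne : a ≠ b)
    (hab : ∃ e, G.Joins e a b) (hO : G.TailFree a b c O) (hsing : ∀ Z : G.ZoneIdx a b c O, ∃ k, Z.1 = {k})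
    (hloop : ∀ e, G.Bare a b e → G.fst e ≠ G.snd e) {u : V} (hu : u ∈ G.BareReach a b c O) :
    G.invalidCount a b c O ≤ G.mCountA a b c O u := by
  refine invalidCount_le_mCountA_of_zone a b c hc hne hab hO hu fun Z => ?_
  obtain ⟨k, hk⟩ := hsing Z
  have hZ : G.IsIdxZone a b c O {k} := hk ▸ Z.2
  have hloop' : ∀ e, G.Bare a b e → ¬ G.Joins e k k := by
    rintro e he (⟨h1, h2⟩ | ⟨h1, h2⟩) <;> exact hloop e he (h1.trans h2.symm)
  rw [hk]
  exact card_Lset_le_card_Rset_singleton a b c (zone_eq_singleton_of_isIdxZone a b c hZ) hZ hloop'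

/-- **THE FIRST END-TO-END INSTANCE, both sides**: on a tail-free `O` all of whose indexed zones (on either side) are
singletons, without bare loops and with an edge between the terminals, both (INV) inequalities hold at every
`u ∈ K₀`. -/
theorem inv_of_singleton_zones (hc : c ≠ a ∧ c ≠ b) (hne : a ≠ b) (hab : ∃ e, G.Joins e a b)
    (hO : G.TailFree a b c O) (hsa : ∀ Z : G.ZoneIdx a b c O, ∃ k, Z.1 = {k})
    (hsb : ∀ Z : G.ZoneIdx b a c O, ∃ k, Z.1 = {k}) (hloop : ∀ e, G.Bare a b e → G.fst e ≠ G.snd e) {u : V}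
    (hu : u ∈ G.BareReach a b c O) :
    G.invalidCount a b c O ≤ G.mCountA a b c O u ∧ G.invalidCount a b c O ≤ G.mCountB a b c O u := by
  refine ⟨invalidCount_le_mCountA_of_singleton_zones a b c hc hne hab hO hsa hloop hu, ?_⟩
  obtain ⟨e, he⟩ := hab
  have h := invalidCount_le_mCountA_of_singleton_zones b a c ⟨hc.2, hc.1⟩ hne.symm ⟨e, he.symm⟩
    ((tailFree_comm a b c O).2 hO) hsb (by rw [bare_comm a b]; exact hloop) (by rw [bareReach_comm]; exact hu)
  rw [invalidCount_comm, mCountA_comm] at h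
  exact h

end Singleton

end MultiGraph

end PercRepro
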